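import Literature.NumberTheory.EllipticCurves.GreenbergVatsal2000.CharacterPAdicLFunctionCProofs
import Literature.NumberTheory.EllipticCurves.GreenbergVatsal2000.CharacterPAdicLFunctionExistence
import HarnessLib

/-!
# Greenberg–Vatsal 2000, §3 pp. 41–42: `L_{Σ₀}(C, T)` and `L_{Σ₀}(D, T)` EXIST in `Λ` —
# the named fact `exists_characterLFunction` is a THEOREM

Greenberg–Vatsal (Invent. Math. 142, p. 42): "The `p`-adic `L`-function `L(D, χ, T) ∈ Λ` is
characterized by the interpolation property (27) … `L(D, χ, T)` is related to the Kubota–Leopoldt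
`p`-adic `L`-function `L_p(ωχ⁻¹ψ⁻¹, s)` by `L_p(ωχ⁻¹ψ⁻¹, s) = ½ L(D, χ, κ(γ)^s − 1)` … To obtain
`L_{Σ₀}(D, χ, T)`, one multiplies by the Euler factors `1 − χψ(l)l⁻¹(1 + T)^{f_l}` for all
`l ∈ Σ₀`."  With the `C`-half (`CharacterPAdicLFunctionCProofs`) this file completes the kernel
proof of the cell's named fact `exists_characterLFunction` (`CharacterPAdicLFunctionExistence.lean`,
registered as F0 / A223 of the BSD rank-≤1 residual cell): the Kubota–Leopoldt–Iwasawa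
construction (Lang, *Cyclotomic Fields I and II*, Ch. 2 §2 and Ch. 4 §§1–3) carried out in
`BernoulliDistributionRelationProofs`, `BernoulliMeasure*Proofs`, `PAdicMeasureTwistedMomentsProofs`,
`PAdicMeasureInversionProofs`, `BernoulliMeasureTransformProofs`, `PAdicPowerSeriesEvaluationProofs`,
`KubotaLeopoldtIwasawaFunctionProofs`.

* properties of `oddCharacterTwist p ψ k` (`= (ωψ⁻¹)ω^{-k}` on integers prime to `p`);
* `exists_eulerFactorD` — the Euler-factor elements `1 − ψ(l)l⁻¹(1+T)^{f_l} ∈ Λ` with their values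
  `1 − ψ(l)ω(l)^{k−1}l^{−k}` at `T = κ(γ)^{1−k} − 1`;
* `exists_isCharacterLFunctionD` — there is `g ∈ Λ` with `IsCharacterLFunctionD p ψ S₀ g`;
* **`exists_characterLFunction_holds : exists_characterLFunction`.**

Everything is proved; the named fact has become a theorem (no new named facts).

## References

* R. Greenberg, V. Vatsal, *On the Iwasawa invariants of elliptic curves*, Invent. Math. 142
  (2000), §3 pp. 41–42. [GreenbergVatsal2000]
* S. Lang, *Cyclotomic Fields I and II*, GTM 121, Springer 1990, Ch. 4 §3 Thm. 3.2 (PDF p. 84).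
  [LangCyclotomic1990]
-/

noncomputable section

open scoped Classical

open NumberField IsDedekindDomain Finset PowerSeries

namespace Literature.NumberTheory.EllipticCurves.GreenbergVatsal2000

open CyclotomicZp PadicOneUnits

variable (p : ℕ) [Fact p.Prime]

/-! ### Places `v ∤ p` -/

omit [Fact p.Prime] in
/-- The cell's spelling of "`v ∤ p`" (`(p : 𝓞 ℚ) ∉ v`) implies `ℓ_v ≠ p`
(Mathlib `Rat.HeightOneSpectrum.natGenerator_dvd_iff`). [folklore] -/
private theorem natGenerator_ne_of_natCast_not_mem {v : HeightOneSpectrum (𝓞 ℚ)}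
    (h : ((p : ℕ) : 𝓞 ℚ) ∉ v.asIdeal) : Rat.HeightOneSpectrum.natGenerator v ≠ p := by
  intro hgen
  apply h
  have hdvd : Rat.HeightOneSpectrum.natGenerator v ∣ p := hgen ▸ dvd_refl _
  rw [Rat.HeightOneSpectrum.natGenerator_dvd_iff] at hdvd
  obtain ⟨x, hx, hxe⟩ := (Ideal.mem_map_of_equiv _ _).mp hdvd
  have : x = (p : 𝓞 ℚ) := by
    apply (Rat.IsIntegralClosure.intEquiv (𝓞 ℚ)).injective
    rw [hxe, map_natCast]
  rwa [this] at hx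

/-! ### The character `θ_k = (ωψ⁻¹)ω^{-k} · 1_{p ∤ ·}` -/

section Character

variable {d : ℕ} (ψ : DirichletCharacter (ZMod p) d)

/-- `θ_k` vanishes on the multiples of `p`. [cite: LangCyclotomic1990, Ch. 2 §2, before Thm. 2.4 (PDF p. 38)] -/
theorem oddCharacterTwist_eq_zero_of_dvd (k : ℕ) {a : ℕ} (ha : p ∣ a) :
    oddCharacterTwist p ψ k a = 0 := by
  unfold oddCharacterTwist
  rw [if_pos ha]

/-- `θ_k` on an integer prime to `p`. [folklore] -/
private theorem oddCharacterTwist_of_not_dvd (k : ℕ) {a : ℕ} (ha : ¬ p ∣ a) :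
    oddCharacterTwist p ψ k a = teichmullerLift p (((a : ZMod p)⁻¹) ^ (k - 1) * (ψ (a : ZMod d))⁻¹) := by
  unfold oddCharacterTwist
  rw [if_neg ha]

/-- `θ_k` is periodic modulo `d p`. [cite: LangCyclotomic1990, Ch. 2 §2, B 6–B 7 (PDF p. 35)] -/
theorem oddCharacterTwist_add_mul (k a : ℕ) :
    oddCharacterTwist p ψ k (a + d * p) = oddCharacterTwist p ψ k a := by
  have h2 : (p ∣ a + d * p) ↔ p ∣ a := Nat.dvd_add_left (dvd_mul_left p d)
  have h3 : ((a + d * p : ℕ) : ZMod d) = a := by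
    rw [Nat.cast_add, (ZMod.natCast_eq_zero_iff _ _).mpr (dvd_mul_right d p), add_zero]
  have h4 : ((a + d * p : ℕ) : ZMod p) = a := by
    rw [Nat.cast_add, (ZMod.natCast_eq_zero_iff _ _).mpr (dvd_mul_left p d), add_zero]
  unfold oddCharacterTwist
  simp only [h2, h3, h4]

/-- `θ_k` is completely multiplicative. [cite: LangCyclotomic1990, Ch. 2 §2, B 6–B 7 (PDF p. 35)] -/
theorem oddCharacterTwist_mul (k x y : ℕ) :
    oddCharacterTwist p ψ k (x * y) = oddCharacterTwist p ψ k x * oddCharacterTwist p ψ k y := by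
  unfold oddCharacterTwist
  by_cases hpx : p ∣ x
  · simp only [hpx, Dvd.dvd.mul_right hpx y, if_true, zero_mul]
  by_cases hpy : p ∣ y
  · simp only [hpy, Dvd.dvd.mul_left hpy x, if_true, mul_zero]
  have hpxy : ¬ p ∣ x * y := fun h ↦ by
    rcases (Nat.Prime.dvd_mul Fact.out).mp h with h | h
    · exact hpx h
    · exact hpy h
  simp only [hpx, hpy, hpxy, if_false, ← teichmullerLift_mul]
  congr 1
  push_cast
  rw [map_mul, mul_inv, mul_inv, mul_pow]
  ring

/-- **The twist relation** `θ_{j+1}(b) η^j = θ_1(b)` for `b ≡ η (mod p)`.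
[cite: LangCyclotomic1990, Ch. 4 §3, proof of Thm. 3.2 (PDF p. 84)] -/
theorem oddCharacterTwist_twist (hp : p ≠ 2) (j b : ℕ) (η : rootsOfUnity (torsionOrder p) ℤ_[p])
    (hb : (b : ZMod p) = PadicInt.toZMod ((η : ℤ_[p]ˣ) : ℤ_[p])) :
    oddCharacterTwist p ψ (j + 1) b * ((η : ℤ_[p]ˣ) : ℤ_[p]) ^ j = oddCharacterTwist p ψ 1 b := by
  unfold oddCharacterTwist
  split_ifs with h1
  · rw [zero_mul]
  · rw [Nat.add_sub_cancel, Nat.sub_self, pow_zero, one_mul, teichmullerLift_mul, teichmullerLift_pow]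
    have h := teichmullerLift_inv_mul_eq_one p hp η hb
    calc teichmullerLift p ((b : ZMod p)⁻¹) ^ j * teichmullerLift p ((ψ (b : ZMod d))⁻¹) *
          ((η : ℤ_[p]ˣ) : ℤ_[p]) ^ j
        = teichmullerLift p ((ψ (b : ZMod d))⁻¹) *
            (teichmullerLift p ((b : ZMod p)⁻¹) * ((η : ℤ_[p]ˣ) : ℤ_[p])) ^ j := by ring
      _ = teichmullerLift p ((ψ (b : ZMod d))⁻¹) := by rw [h, one_pow, mul_one]

end Character

/-! ### The regulariser for `D`: `c ≡ 1 (mod d)`, `c ≡ 2 (mod p)` -/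

/-- **Choice of `c` for `D`**: with `c ≡ 1 (mod d)` and `c ≡ 2 (mod p)` one has `ψ(c) = 1` and
`1 − θ_1(c)c ≡ 1 − 2 = −1 (mod p)`, a unit (Lang Ch. 4 §3 "select `c` such that `χ(c) ≠ 1`", here
for `χ = ωψ⁻¹`). [cite: LangCyclotomic1990, Ch. 4 §3, definition of L_p (PDF p. 84)] -/
theorem exists_regulariser_D (hp : p ≠ 2) {d : ℕ} [NeZero d] (hpd : ¬ p ∣ d)
    (ψ : DirichletCharacter (ZMod p) d) :
    ∃ c : ℕ, c.Coprime (d * p * p) ∧ IsUnit (1 - oddCharacterTwist p ψ 1 c * c : ℤ_[p]) := by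
  have pp : p.Prime := Fact.out
  have hcop : d.Coprime p := ((Nat.Prime.coprime_iff_not_dvd pp).mpr hpd).symm
  obtain ⟨c, hc1, hc2⟩ := Nat.chineseRemainder hcop 1 2
  have hcd : c.Coprime d := by
    have h := hc1.gcd_eq; rwa [Nat.gcd_one_left] at h
  have hcp : c.Coprime p := by
    have h := hc2.gcd_eq
    show c.gcd p = 1
    rw [h]
    exact (Nat.coprime_primes Nat.prime_two pp).mpr (Ne.symm hp)
  have hpc : ¬ p ∣ c := fun h ↦ by
    have := Nat.dvd_gcd h (dvd_refl p)
    rw [hcp] at this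
    exact pp.one_lt.ne' (Nat.dvd_one.mp this)
  refine ⟨c, (hcd.mul_right hcp).mul_right hcp, ?_⟩
  apply isUnit_of_toZMod_ne_zero
  have hcd' : (c : ZMod d) = 1 := by
    have := (ZMod.natCast_eq_natCast_iff' c 1 d).mpr hc1
    rwa [Nat.cast_one] at this
  have hcp' : (c : ZMod p) = 2 := by
    have := (ZMod.natCast_eq_natCast_iff' c 2 p).mpr hc2
    rwa [Nat.cast_ofNat] at this
  rw [map_sub, map_one, map_mul, map_natCast, oddCharacterTwist_of_not_dvd p ψ 1 hpc,
    toZMod_teichmullerLift, Nat.sub_self, pow_zero, one_mul, hcd', map_one, inv_one,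
    one_mul, hcp']
  haveI : Fact (1 < p) := ⟨pp.one_lt⟩
  intro h0
  have h1 : (1 : ZMod p) = 0 := by linear_combination -h0
  exact one_ne_zero h1

/-! ### The Euler factors `1 − ψ(l)l⁻¹(1 + T)^{f_l}` -/

/-- **The Euler-factor element at `l ∈ Σ₀`** (GV p. 42: "one multiplies by the Euler factors
`1 − χψ(l)l⁻¹(1 + T)^{f_l}` for all `l ∈ Σ₀`. The value at `T = ζ − 1` is the `l`-th Euler factor
`1 − χψρ(l)l⁻¹`"): for a prime `l ≠ p` there is `e_l ∈ Λ` whose value at `T = κ(γ)^{−j} − 1` is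
`1 − ψ(l)ω(l)^{j} l^{−(j+1)}` for every `j ≥ 0` (`⟨l⟩ = γ^{f_l}`, `l = ω(l)⟨l⟩`).
[cite: GreenbergVatsal2000, §3 p. 42 (the Euler factors of L_{Σ₀}(D,χ,T))] -/
theorem exists_eulerFactorD (hp : p ≠ 2) {d : ℕ} (ψ : DirichletCharacter (ZMod p) d) {ℓ : ℕ}
    (hℓ : ℓ.Prime) (hℓp : ℓ ≠ p) :
    ∃ e : PowerSeries ℤ_[p], ∀ j : ℕ,
      HasSum (fun n ↦ ((PowerSeries.coeff n e : ℤ_[p]) : ℚ_[p]) *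
          ((((cyclotomicGenerator p : ℕ) : ℚ_[p])⁻¹) ^ j - 1) ^ n)
        (1 - ((teichmullerLift p (ψ (ℓ : ZMod d)) * teichmullerLift p (ℓ : ZMod p) ^ j : ℤ_[p]) :
            ℚ_[p]) * ((ℓ : ℚ_[p])⁻¹) ^ (j + 1)) := by
  have pp : p.Prime := Fact.out
  have hpl : ¬ p ∣ ℓ := fun h ↦ hℓp ((Nat.prime_dvd_prime_iff_eq pp hℓ).mp h).symm
  have hlunit : IsUnit (ℓ : ℤ_[p]) := by
    rw [PadicInt.isUnit_iff, ← PadicInt.padic_norm_e_of_padicInt, PadicInt.coe_natCast,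
      Padic.norm_natCast_eq_one_iff]
    exact (Nat.Prime.coprime_iff_not_dvd pp).mpr hpl
  obtain ⟨ζ, f, hlf, hζ⟩ := exists_rootsOfUnity_mul_cycPow p hlunit.unit
  rw [IsUnit.unit_spec] at hlf hζ
  rw [map_natCast] at hζ
  have hζω : teichmullerLift p (ℓ : ZMod p) = ((ζ : ℤ_[p]ˣ) : ℤ_[p]) := by
    rw [← hζ]; exact teichmullerLift_toZMod_rootsOfUnity p hp ζ
  set a : ℤ_[p] := teichmullerLift p (ψ (ℓ : ZMod d)) * ((hlunit.unit⁻¹ : ℤ_[p]ˣ) : ℤ_[p]) with ha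
  refine ⟨1 - PowerSeries.C a * PowerSeries.binomialSeries ℤ_[p] f, fun j ↦ ?_⟩
  have h := hasSum_intCoeff_one_sub_C_mul_binomialSeries p a (-(j : ℤ_[p])) f
  rw [coe_cycPow_neg_natCast] at h
  convert h using 2
  -- `a γ^{-jf} = ω(ψ l) ω(l)^j l^{-(j+1)}`
  have hℓ0 : (ℓ : ℚ_[p]) ≠ 0 := by exact_mod_cast hℓ.ne_zero
  have hζ0 : (((ζ : ℤ_[p]ˣ) : ℤ_[p]) : ℚ_[p]) ≠ 0 := by
    rw [ne_eq, PadicInt.coe_eq_zero]; exact (ζ : ℤ_[p]ˣ).ne_zero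
  have hinv : (((hlunit.unit⁻¹ : ℤ_[p]ˣ) : ℤ_[p]) : ℚ_[p]) = (ℓ : ℚ_[p])⁻¹ := by
    refine eq_inv_of_mul_eq_one_left ?_
    rw [← PadicInt.coe_natCast, ← PadicInt.coe_mul, hlunit.val_inv_mul, PadicInt.coe_one]
  have hcyc : ((cycPow p f : ℤ_[p]) : ℚ_[p]) = (ℓ : ℚ_[p]) * ((((ζ : ℤ_[p]ˣ) : ℤ_[p]) : ℚ_[p]))⁻¹ := by
    rw [eq_mul_inv_iff_mul_eq₀ hζ0, mul_comm, ← PadicInt.coe_mul, ← hlf, PadicInt.coe_natCast]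
  have hneg : ((cycPow p (-(j : ℤ_[p]) * f) : ℤ_[p]) : ℚ_[p]) =
      (((cycPow p f : ℤ_[p]) : ℚ_[p]) ^ j)⁻¹ := by
    refine eq_inv_of_mul_eq_one_left ?_
    rw [← PadicInt.coe_pow, ← PadicInt.coe_mul, ← AddChar.map_nsmul_eq_pow, nsmul_eq_mul,
      ← AddChar.map_add_eq_mul, neg_mul, neg_add_cancel, AddChar.map_zero_eq_one, PadicInt.coe_one]
  rw [hneg, hcyc, ha]
  push_cast
  rw [hinv, hζω]
  simp only [mul_pow, mul_inv, inv_inv, inv_pow]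
  ring

/-- Values of finite products of elements of `Λ` (multiplicativity of evaluation).
[cite: LangCyclotomic1990, Ch. 4 §1, Thm. 1.2 (PDF p. 79)] -/
theorem hasSum_intCoeff_prod_mul_pow {ι : Type*} (s : Finset ι) (F : ι → PowerSeries ℤ_[p])
    (a : ι → ℚ_[p]) {z : ℚ_[p]} (hz : ‖z‖ < 1)
    (h : ∀ i ∈ s, HasSum (fun n ↦ ((PowerSeries.coeff n (F i) : ℤ_[p]) : ℚ_[p]) * z ^ n) (a i)) :
    HasSum (fun n ↦ ((PowerSeries.coeff n (∏ i ∈ s, F i) : ℤ_[p]) : ℚ_[p]) * z ^ n)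
      (∏ i ∈ s, a i) := by
  induction s using Finset.induction_on with
  | empty =>
    simp only [Finset.prod_empty]
    exact hasSum_intCoeff_one_mul_pow z
  | insert i s hi ih =>
    rw [Finset.prod_insert hi, Finset.prod_insert hi]
    exact hasSum_intCoeff_mul_mul_pow hz (h i (Finset.mem_insert_self i s))
      (ih fun k hk ↦ h k (Finset.mem_insert_of_mem hk))

/-! ### Existence of `L_{Σ₀}(D, T)` and the named fact -/

/-- **Greenberg–Vatsal p. 42 / Kubota–Leopoldt–Iwasawa: `L_{Σ₀}(D, T) ∈ Λ` exists** — for an odd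
prime `p`, a Dirichlet character `ψ` modulo `d` with `p ∤ d` (values in `𝔽_p`) and a finite set
`Σ₀` of places not above `p`, there is `g ∈ Λ` with `IsCharacterLFunctionD p ψ Σ₀ g`
(`g(κ(γ)^{1−k} − 1) = 2·(−(1/k)B_{k,(ωψ⁻¹)ω^{-k}})·∏_{l∈Σ₀}(1 − ψ(l)ω(l)^{k−1}l^{−k})`): the Iwasawa
function of the INVERTED measure of `θE_{1,c}`, `θ = ψ⁻¹·1_{p∤·}` (so that the values sit at
`κ(γ)^{s} − 1`, GV's normalisation for `D`), times `2` and the Euler-factor elements.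
[cite: GreenbergVatsal2000, §3 p. 42 (L(D,χ,T) ∈ Λ, its relation with L_p(ωχ⁻¹ψ⁻¹,s), Σ₀-depletion)]
[cite: LangCyclotomic1990, Ch. 4 §3, Thm. 3.2 (PDF p. 84)] -/
theorem exists_isCharacterLFunctionD {d : ℕ} [NeZero d] (ψ : DirichletCharacter (ZMod p) d)
    (S₀ : Finset (HeightOneSpectrum (𝓞 ℚ))) (hp : p ≠ 2) (hpd : ¬ p ∣ d)
    (hS : ∀ v ∈ S₀, ((p : ℕ) : 𝓞 ℚ) ∉ v.asIdeal) :
    ∃ g : IwasawaAlgebra p, IsCharacterLFunctionD p ψ S₀ g := by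
  have pp : p.Prime := Fact.out
  obtain ⟨c, hc, hunit⟩ := exists_regulariser_D p hp hpd ψ
  haveI : NeZero (d * p) := ⟨mul_ne_zero (NeZero.ne d) pp.ne_zero⟩
  obtain ⟨_g, g', hg⟩ := exists_iwasawaFunction_of_bernoulliMeasure p hp hc
    (θ := oddCharacterTwist p ψ 1)
    (oddCharacterTwist_add_mul p ψ 1)
    (fun b hb ↦ oddCharacterTwist_eq_zero_of_dvd p ψ 1 hb) hunit
    (fun j ↦ oddCharacterTwist p ψ (j + 1))
    (fun j ↦ oddCharacterTwist_add_mul p ψ (j + 1))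
    (fun j b hb ↦ oddCharacterTwist_eq_zero_of_dvd p ψ (j + 1) hb)
    (fun j ↦ oddCharacterTwist_mul p ψ (j + 1) c)
    (fun j b η hb ↦ oddCharacterTwist_twist p ψ hp j b η hb)
  -- Euler factors
  have hE : ∀ v : HeightOneSpectrum (𝓞 ℚ), ∃ e : PowerSeries ℤ_[p], v ∈ S₀ → ∀ j : ℕ,
      HasSum (fun n ↦ ((PowerSeries.coeff n e : ℤ_[p]) : ℚ_[p]) *
          ((((cyclotomicGenerator p : ℕ) : ℚ_[p])⁻¹) ^ j - 1) ^ n)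
        (1 - ((teichmullerLift p (ψ (Rat.HeightOneSpectrum.natGenerator v : ZMod d)) *
              teichmullerLift p (Rat.HeightOneSpectrum.natGenerator v : ZMod p) ^ j : ℤ_[p]) :
            ℚ_[p]) * ((Rat.HeightOneSpectrum.natGenerator v : ℚ_[p])⁻¹) ^ (j + 1)) := by
    intro v
    by_cases hv : v ∈ S₀
    · obtain ⟨e, he⟩ := exists_eulerFactorD p hp ψ (Rat.HeightOneSpectrum.prime_natGenerator v)
        (natGenerator_ne_of_natCast_not_mem p (hS v hv))
      exact ⟨e, fun _ ↦ he⟩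
    · exact ⟨1, fun h ↦ absurd h hv⟩
  choose e he using hE
  refine ⟨PowerSeries.C (2 : ℤ_[p]) * g' * ∏ v ∈ S₀, e v, fun k hk ↦ ?_⟩
  obtain ⟨j, rfl⟩ : ∃ j, k = j + 1 := ⟨k - 1, by omega⟩
  have hz : ‖(((cyclotomicGenerator p : ℕ) : ℚ_[p])⁻¹) ^ j - 1‖ < 1 :=
    norm_cyclotomicGenerator_inv_pow_sub_one_lt j
  have h2 := hasSum_intCoeff_C_mul_pow (2 : ℤ_[p]) ((((cyclotomicGenerator p : ℕ) : ℚ_[p])⁻¹) ^ j - 1)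
  have hg' := (hg j).2
  have hprod := hasSum_intCoeff_prod_mul_pow p S₀ e _ hz fun v hv ↦ he v hv j
  have h := hasSum_intCoeff_mul_mul_pow hz (hasSum_intCoeff_mul_mul_pow hz h2 hg') hprod
  simp only [Nat.add_sub_cancel]
  convert h using 1
  have h2c : ((2 : ℤ_[p]) : ℚ_[p]) = 2 := map_ofNat (PadicInt.Coe.ringHom (p := p)) 2
  unfold characterLValueD twistedBernoulli
  rw [Nat.add_sub_cancel, one_div, h2c]
  ring

/-- **The named fact `exists_characterLFunction` (F0 of the X2 cell; Greenberg–Vatsal 2000 §3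
pp. 41–42 with Lang Ch. 4 Thm. 3.2 — the Kubota–Leopoldt–Iwasawa existence of `L_{Σ₀}(C, T)` and
`L_{Σ₀}(D, T)` in `Λ`) is a THEOREM.** [cite: GreenbergVatsal2000, §3 pp. 41–42 (L(C,χ,T), L(D,χ,T) ∈ Λ characterized by (26)/(27))]
[cite: LangCyclotomic1990, Ch. 4 §3 Thm. 3.2 and Ch. 10 §1–§2 Thm. 2.1 (Iwasawa power series of the Kubota–Leopoldt L-function)] -/
theorem exists_characterLFunction_holds : exists_characterLFunction :=
  ⟨fun p _ _m _ φ S₀ hp hpm hφ _ _ ↦ exists_isCharacterLFunctionC p φ S₀ hp hpm hφ,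
    fun p _ _d _ ψ S₀ hp hpd _ _ hS ↦ exists_isCharacterLFunctionD p ψ S₀ hp hpd hS⟩

end Literature.NumberTheory.EllipticCurves.GreenbergVatsal2000

end
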